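import Mathlib
import Summits.Ventures.PercRepro2.HCov
import Summits.Ventures.PercRepro2.RootLeafUSigns
import Summits.Ventures.PercRepro2.RootLeafUMixK
import Summits.Ventures.PercRepro2.RootLeafUCoin3Outside
import Summits.Ventures.PercRepro2.RootLeafUThreshold
import Summits.Ventures.PercRepro2.BHKOutside
import Summits.Ventures.PercRepro2.ExploreA3

/-!
# (G4-u): the (MIX-K) threshold dominates the `b`-share of the `PD` world on EVERY instance
(blind cell PercRepro2, p4 g18; S3 (G4-u) item (ae), proofs/P4-G18-PDTHRESHOLD.md)

With `A = α + κ`, `β = S·D + d0·Z` the constants of RootLeafUHalf / MixK, `D = P(PD)`,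
`t = P(T)`, `t′ = P(T′)`, `hb = P(bK)`, `hc = P(cK) = S − d0` and `P(Q, bL) = P(PD,bL) + P(T,bL) + P(T′,bL)`:

  `A·D − 2β·P(PD,bK) = 2·[ (D + t′)·(hb·D − P(PD,bK)) + hc·(t′·P(PD,bK) − D·P(T′,bK))
                          + d0·(D·P(T,bK) − t·P(PD,bK)) + D·(hc·P(Q,bL) − P(T,bL)) ]`

— an exact identity after `Qsplit` and `gap_eq_Q`, and every bracket is a standard fact: Harris
(`P(PD,bK) ≤ hb·D`), BHK06 1.4 in the `K`-avoids-`{u, c}` world (`MixK.HoK_nonneg` at `o := b`),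
BHK06 1.3 for the cluster `K` in the world `R = {u ↮ a₂, u ↮ c}` (`bhk_two_outside_avoid`: `b ∈ K`
and `c ∈ K` positively correlated given that `C(u)` avoids `{a₂, c}`), and the tower bound
`P(T, bL) ≤ hc·P(Q, bL)` (explore `C(u)`: the residual probability of `a₂ ↔ c` in `G ∖ C(u)` is at
most the global one, `delClusterProb_mem_le`).  Hence **`2β·P(PD, bK) ≤ A·D`** (`A_mul_D_ge`):
`λ = A/(2β) ≥ P(bK | PD)` on every instance — the `PD`-conditional form of the threshold lemma
`Threshold.A_mul_P0_ge` (`λ ≥ P(bK | Q, c ∉ K)`).  On the boundary-`{u, a₂, c}` pocket classes it is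
exactly the `K`-side scalar `M_K ≥ 0` of the (K) exploration identity (`M_K·D₀ = A·D − 2β·(P(PD,bK) −
P(PD, b ↔ c))`), so the `o ∈ K` half of W1 on every such pocket reduces to the pocket identity.
-/

namespace Summit.Ventures.PercRepro2

open UnionCluster CovForm

namespace RootLeafU

namespace ThresholdPD

variable {V : Type*} {E : Type*} [Fintype E] [DecidableEq E] [Fintype V] [DecidableEq V]
  {R : Type*} [Field R] [LinearOrder R] [IsStrictOrderedRing R]

variable (p : E → R) (ends : E → Sym2 V) (a₂ c b u : V)

omit [Fintype E] [DecidableEq E] [Fintype V] [DecidableEq V] in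
/-- `PD = {u ↮ a₂, c ∉ L ∪ K}` is a decreasing event. -/
lemma isLowerSet_PDEvent : IsLowerSet (PDEvent ends u a₂ c) := by
  intro ω ω' hle hω
  refine ⟨fun hc => hω.1 (conn_mono hle hc), fun hc => hω.2 ?_⟩
  rcases hc with hc | hc
  · exact Or.inl (conn_mono hle hc)
  · exact Or.inr (conn_mono hle hc)

omit [Fintype V] [DecidableEq V] in
/-- Harris: `P(PD, bK) ≤ hb · D`. -/
lemma PDbK_le (hp : IsProbVec p) :
    prob p (PDEvent ends u a₂ c ∩ connEvent ends a₂ b) ≤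
      prob p (connEvent ends a₂ b) * prob p (PDEvent ends u a₂ c) := by
  have h := prob_inter_le_prob_mul_prob_of_isLowerSet hp (isLowerSet_PDEvent ends a₂ c u)
    (isUpperSet_connEvent ends a₂ b)
  linarith

/-- BHK06 1.3 for `K` in the world `R = {u ↮ a₂, u ↮ c}`: `P(PD, bK) · t ≤ P(T, bK) · D`
(`b ∈ K` and `c ∈ K` are positively correlated given that `C(u)` avoids `{a₂, c}`). -/
lemma PDbK_mul_t_le (hp : IsProbVec p) :
    prob p (PDEvent ends u a₂ c ∩ connEvent ends a₂ b) * prob p (TEvent ends u a₂ c) ≤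
      prob p (TEvent ends u a₂ c ∩ connEvent ends a₂ b) * prob p (PDEvent ends u a₂ c) := by
  classical
  have h := bhk_two_outside_avoid p hp ends u a₂ a₂ ({a₂, c} : Finset V)
    (isUpperSet_mem_setOf b) (isUpperSet_mem_setOf c)
  have hins : insert a₂ ({a₂, c} : Finset V) = {a₂, c} := Finset.insert_eq_of_mem (by simp)
  rw [hins, hins, ExploreA3.clusterInEvent_mem_eq, ExploreA3.clusterInEvent_mem_eq] at h
  have hR := ISplit.prob_PD_add_T p ends u a₂ c Set.univ
  have hRb := ISplit.prob_PD_add_T p ends u a₂ c (connEvent ends a₂ b)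
  simp only [Set.inter_univ] at hR
  have e1 : connEvent ends a₂ b ∩ avoidAll ends u {a₂, c} =
      avoidAll ends u {a₂, c} ∩ connEvent ends a₂ b := Set.inter_comm _ _
  have e2 : connEvent ends a₂ c ∩ avoidAll ends u {a₂, c} = TEvent ends u a₂ c :=
    conn_inter_R ends u a₂ c
  have e3 : connEvent ends a₂ b ∩ connEvent ends a₂ c ∩ avoidAll ends u {a₂, c} =
      TEvent ends u a₂ c ∩ connEvent ends a₂ b := by
    rw [ISplit.T_eq_R_inter]
    ext ω
    simp only [Set.mem_inter_iff]
    tauto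
  rw [e1, e2, e3, ← hR, ← hRb] at h
  nlinarith [h]

omit [DecidableEq V] in
/-- The tower bound for `T ∩ {b ∈ L}`: `P(T, bL) ≤ hc · P(Q, bL)` — explore `C(u)`; given `C(u)`
(with `a₂ ∉ C(u)`, `b ∈ C(u)`) the cluster of `a₂` lives in `G ∖ C(u)`, whose connection
probability `P_{G∖C(u)}(a₂ ↔ c)` is at most `P(a₂ ↔ c)`. -/
lemma TbL_le (hp : IsProbVec p) :
    prob p (TEvent ends u a₂ c ∩ connEvent ends u b) ≤
      prob p (connEvent ends a₂ c) * prob p (avoidAll ends a₂ {u} ∩ connEvent ends u b) := by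
  classical
  have ha2 : a₂ ∈ ({a₂} : Finset V) := by simp
  have tB := prob_clusterIn_inter_avoid_eq_expect p ends u a₂ ha2 {W | b ∈ W} {W | c ∈ W}
  have t1 := prob_clusterIn_inter_avoid_eq_expect p ends u a₂ ha2 {W | b ∈ W} Set.univ
  have hg1 : ∀ K, delClusterProb p ends a₂ Set.univ K = 1 := delClusterProb_univ p ends a₂
  simp only [clusterInEvent_univ, Set.inter_univ, hg1, mul_one] at t1
  rw [ExploreA3.clusterInEvent_mem_eq, ExploreA3.clusterInEvent_mem_eq] at tB
  rw [ExploreA3.clusterInEvent_mem_eq] at t1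
  have e1 : connEvent ends u b ∩ connEvent ends a₂ c ∩ avoidAll ends u {a₂} =
      TEvent ends u a₂ c ∩ connEvent ends u b := by
    rw [Coin3.avoidAll_singleton_eq_compl]
    ext ω
    simp only [Set.mem_inter_iff, Set.mem_compl_iff, mem_connEvent, TEvent]
    constructor
    · rintro ⟨⟨hub, hac⟩, hua⟩
      exact ⟨⟨fun h => hua (conn_symm h), hac⟩, hub⟩
    · rintro ⟨⟨hau, hac⟩, hub⟩
      exact ⟨⟨hub, hac⟩, fun h => hau (conn_symm h)⟩
  have e2 : connEvent ends u b ∩ avoidAll ends u {a₂} = avoidAll ends a₂ {u} ∩ connEvent ends u b := by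
    rw [Coin3.avoidAll_singleton_eq_compl, Coin3.avoidAll_singleton_eq_compl, Set.inter_comm,
      Threshold.connEvent_comm ends a₂ u]
  rw [e1] at tB
  rw [e2] at t1
  rw [tB, t1, ← expect_const_mul]
  refine expect_mono hp fun ω => ?_
  have h1 : delClusterProb p ends a₂ {W | c ∈ W} (cluster ends ω u) ≤
      prob p (connEvent ends a₂ c) := delClusterProb_mem_le p ends hp a₂ c _
  have h2 : (0 : R) ≤ ({W : Set V | b ∈ W} : Set (Set V)).indicator 1 (cluster ends ω u) :=
    Set.indicator_apply_nonneg fun _ => zero_le_one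
  have h3 : (0 : R) ≤ (avoidAll ends u {a₂}).indicator 1 ω :=
    Set.indicator_apply_nonneg fun _ => zero_le_one
  calc ({W : Set V | b ∈ W} : Set (Set V)).indicator 1 (cluster ends ω u) *
        delClusterProb p ends a₂ {W | c ∈ W} (cluster ends ω u) * (avoidAll ends u {a₂}).indicator 1 ω
      ≤ ({W : Set V | b ∈ W} : Set (Set V)).indicator 1 (cluster ends ω u) *
        prob p (connEvent ends a₂ c) * (avoidAll ends u {a₂}).indicator 1 ω := by
        gcongr
    _ = prob p (connEvent ends a₂ c) *
        (({W : Set V | b ∈ W} : Set (Set V)).indicator 1 (cluster ends ω u) *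
          (avoidAll ends u {a₂}).indicator 1 ω) := by ring

/-- **The threshold dominates the `PD`-share**: `2β · P(PD, bK) ≤ A · D` on every instance
(`A`, `β` as in RootLeafUHalf / MixK / Threshold, `S = P(Ω)`). -/
theorem A_mul_D_ge (hp : IsProbVec p) :
    2 * (prob p Set.univ * prob p (PDEvent ends u a₂ c) + prob p (avoidAll ends a₂ {c}) * prob p (avoidAll ends a₂ {u})) *
        prob p (PDEvent ends u a₂ c ∩ connEvent ends a₂ b) ≤
      ((prob p (PDEvent ends u a₂ c) * prob p (connEvent ends a₂ b) + prob p (avoidAll ends a₂ {c}) * gap p ends u a₂ b) +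
          (prob p Set.univ * EQb3 p ends u a₂ c b + prob p Set.univ * PDb p ends u a₂ c b +
            prob p (connEvent ends a₂ b) * EQ3 p ends u a₂ c + prob p (connEvent ends a₂ b) * prob p (avoidAll ends a₂ {u}) -
            (prob p Set.univ - prob p (avoidAll ends a₂ {c})) * gap p ends u a₂ b)) *
        prob p (PDEvent ends u a₂ c) := by
  have h1 := PDbK_le p ends a₂ c b u hp
  have h2 := MixK.HoK_nonneg p ends b a₂ c u hp
  have h3 := PDbK_mul_t_le p ends a₂ c b u hp
  have h4 := TbL_le p ends a₂ c b u hp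
  have hhc := Coin3.out_hca p ends a₂ c
  have hD : 0 ≤ prob p (PDEvent ends u a₂ c) := prob_nonneg hp _
  have hTp : 0 ≤ prob p (TEvent ends a₂ u c) := prob_nonneg hp _
  have hd0 : 0 ≤ prob p (avoidAll ends a₂ {c}) := prob_nonneg hp _
  have hhc0 : 0 ≤ prob p (connEvent ends a₂ c) := prob_nonneg hp _
  have t1 := mul_nonneg (add_nonneg hD hTp) (sub_nonneg.mpr h1)
  have t2 := mul_nonneg hhc0 h2
  have t3 := mul_nonneg hd0 (sub_nonneg.mpr h3)
  have t4 := mul_nonneg hD (sub_nonneg.mpr h4)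
  rw [Qsplit p ends u a₂ c (connEvent ends u b)] at t4
  unfold EQb3 PDb EQ3
  rw [prob_univ, gap_eq_Q p ends u a₂ b, Qsplit p ends u a₂ c (connEvent ends a₂ b),
    Qsplit p ends u a₂ c (connEvent ends u b), Qsplit_univ p ends u a₂ c]
  rw [hhc] at t2 t4
  nlinarith [t1, t2, t3, t4]

end ThresholdPD

end RootLeafU

end Summit.Ventures.PercRepro2
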